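import Summits.KontsevichZagierPeriods.KontsevichZagierPeriods.Theorems.GpcLegendreLemniscatic.Negative.ChainStart
import Summits.KontsevichZagierPeriods.KontsevichZagierPeriods.Theorems.GrothendieckGpcLegendreLemniscaticStubFibration
import Summits.KontsevichZagierPeriods.KontsevichZagierPeriods.Theorems.GrothendieckGpcLegendreLemniscaticStubPencilCalculus
import Summits.KontsevichZagierPeriods.KontsevichZagierPeriods.Theorems.GrothendieckGpcLegendreLemniscaticStubConicPencil
import Summits.KontsevichZagierPeriods.KontsevichZagierPeriods.Theorems.UnfoldedStokesLegendreAllModuliStubStripNewtonLeibniz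
import Summits.KontsevichZagierPeriods.KontsevichZagierPeriods.Theorems.UnfoldedStokesLegendreAllModuliStubHalfLineTail

/-!
# `GpcLegendreLemniscatic` (stmt-KontsevichZagierPeriods-0280) — line `hyperbola-fibration-conic`: the crux

**Theorem.** Legendre's relation at the lemniscatic modulus, `2E(1/√2)K(1/√2) − K(1/√2)² = π/2`, is
*KZ-accessible*: for every `r : KZ.IntegralRep 2` with domain `(0,1)²` and integrand
`(2e(x₀) − k(x₀))·k(x₁)` (`k`, `e` the `K(1/√2)`, `E(1/√2)` densities) and every `r' : KZ.IntegralRep 1`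
with domain `ℝ` and integrand `1/(2(1+x²))`, one passes from `r` to `r'` by the four moves of the
Kontsevich–Zagier calculus (`KZ.Equivalent r r'`) — route Grothendieck, crux of rank 5 (shared with
VeryGoodTransfer `LegendreCompiled`, ZeroPortrait, UnfoldedStokes `LegendreLemniscatic`).

## The chain (every intermediate representation absolutely convergent, every map ℚ-semialgebraic)

Write `z 0, z 1` for coordinates on `Fin 2 → ℝ`. By `gpcLegendre_iff` (Theorems/…/Negative/Canonical) it
suffices to treat the canonical pair `legendreRep = [g]·[k]`, `arctanRep = [ℝ, 1/(2(1+y²))]`.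

* **M0 quartic twist** (registered stub `stub_quarticTwist`; in the tree as
  `GpcLegendreLemniscaticNegative.equivalent_legendreRep_lemniscateRep`, `Negative/ChainStart`): Lawden's `x = √(1 − t²)` in each factor (two rule-(2)
  moves glued by `Equivalent.prod`): `legendreRep ~ [(0,1)², 2z0²/(√(1−z0⁴)√(1−z1⁴))]` — the
  lemniscatic product `2·∫t²dt/√(1−t⁴) · ∫dt/√(1−t⁴)` (Euler 1738/1782).
* **M1 hyperbola fibration** (`stub_fibration`): the one-coordinate substitution
  `z ↦ update z 1 (z0·z1)` (pencil `t = x₀x₁`, fibre coordinate `y = x₀`), Jacobian `z0`, rule (2):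
  `~ [{0 < z1 < z0 < 1}, 2z0³/(√(1−z0⁴)√(z0⁴−z1⁴))]`.
* **M2 conic rationalisation** (`stub_pencilCalculus`, `stub_conicPencil`): on the fibre `z1 = t` the
  restricted form is a period of the conic `v² = (1−u)(u−t⁴)` (`u = y⁴`); the one-coordinate
  substitution `z ↦ update z 0 w`, `w = √((y⁴−t⁴)/(1−y⁴)) ∈ (0,∞)`, has Jacobian
  `∂w/∂y = 2y³(1−t⁴)/(w(1−y⁴)²)` and `1 + w² = (1−t⁴)/(1−y⁴)`, so the pull-back identity
  `2y³/(√(1−y⁴)√(y⁴−t⁴)) = (1/(1+w²))·|∂w/∂y|` holds EXACTLY and rule (2) gives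
  `~ [{0 < z0} ∩ {0 < z1 < 1}, 1/(1 + z0²)]` — `π` appears fibrewise as the conic period.
* **M3 Newton–Leibniz** (registered stub `stub_stripNewtonLeibniz`; the byte-identical statement was
  landed first by the sister line of crux `LegendreAllModuli` as
  `UnfoldedStokes.LegendreAllModuliLine.stub_stripNewtonLeibniz`, which is consumed here): ONE rule-(3) move along the last coordinate
  `t ∈ [0,1]` with the polynomial-in-`t` primitive `t/(1+w²)` (closed band vs open strip differ by null
  faces): `~ [(0,∞), 1/(1+y²)]`.
* **M4 half-line to line** (registered stub `stub_halfLineTail`; consumed from the sister line as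
  `UnfoldedStokes.LegendreAllModuliLine.stub_halfLineTail`): reflection `y ↦ −y` (rule 2), halving the integrand
  (rule 1b), `ℝ ∖ {0} = (−∞,0) ∪ (0,∞)` (rule 1a) and the null point: `~ arctanRep`.

Exactly one Newton–Leibniz move is used (≥ 1 is necessary: `Negative/LoadBearing`,
`legendre_not_mem_closure_without_newtonLeibniz`) and additivity is used (necessary, Disproof §8); no
termwise transfer of `[k]·[k]` or `[e]·[k]` is attempted (impossible, `Negative/Strengthenings`): the twist
mixes the `E`- and `K`-parts before the fibration. No special value (`Γ(¼)`, Beta integrals), no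
modulus deformation, no uniformisation enters: the only transcendental input is `∫ dw/(1+w²)`.

References: M. Kontsevich, D. Zagier, *Periods* (2001), §1.1–1.2; D. F. Lawden, *Elliptic Functions
and Applications* (1989), §3.8 (3.8.29), Ch. 3 Ex. 24–25, §4.3; H. McKean, V. Moll, *Elliptic Curves*
(1999), §2.4.
-/

noncomputable section

open Set
open Literature.NumberTheory.Transcendental
open Literature.NumberTheory.Transcendental.KZ
open Summit.KontsevichZagierPeriods.KontsevichZagierPeriods.Theses.Grothendieck (GpcLegendreLemniscatic)
open Summit.KontsevichZagierPeriods.Grothendieck.GpcLegendreLemniscaticNegative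

namespace Summit.KontsevichZagierPeriods.Grothendieck.GpcLegendreLemniscaticLine

/-- **Legendre's relation at `k² = 1/2` is KZ-accessible** (crux `GpcLegendreLemniscatic` of route
Grothendieck, stmt-KontsevichZagierPeriods-0280): composition of the five moves M0–M4 of the line
`hyperbola-fibration-conic`, `legendreRep ~ q ~ T ~ p ~ a ~ arctanRep`, transported to every admissible
pair `(r, r')` by `gpcLegendre_iff`. [cite: KontsevichZagier2001, §1.2] -/
theorem GpcLegendreLemniscatic_proof : GpcLegendreLemniscatic := by
  -- M0 (registered stub `stub_quarticTwist`, supplied by `Negative/ChainStart`)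
  have hM0 : ∃ q : IntegralRep 2, q.domain = unitSq ∧
      Set.EqOn q.integrand (fun x => 2 * x 0 ^ 2 / (Real.sqrt (1 - x 0 ^ 4) * Real.sqrt (1 - x 1 ^ 4))) unitSq ∧
      Equivalent legendreRep q :=
    ⟨lemniscateRep, lemniscateRep_domain, fun x _ => lemniscateRep_integrand_apply x,
      equivalent_legendreRep_lemniscateRep⟩
  obtain ⟨q, hqd, hqi, hq⟩ := hM0
  -- M1, M2 (this line's landed stubs)
  obtain ⟨T, hTd, hTi, hT⟩ := stub_fibration q hqd hqi
  obtain ⟨p, hpd, hpi, hp⟩ := stub_conicPencil stub_pencilCalculus T hTd hTi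
  -- M3, M4 (registered stubs `stub_stripNewtonLeibniz`, `stub_halfLineTail`; byte-identical statements
  -- landed by the sister line of crux `LegendreAllModuli`, consumed directly)
  obtain ⟨a, had, hai, ha⟩ :=
    Summit.KontsevichZagierPeriods.UnfoldedStokes.LegendreAllModuliLine.stub_stripNewtonLeibniz p hpd hpi
  exact gpcLegendre_iff.mpr (hq.trans (hT.trans (hp.trans (ha.trans
    (Summit.KontsevichZagierPeriods.UnfoldedStokes.LegendreAllModuliLine.stub_halfLineTail a had hai)))))

end Summit.KontsevichZagierPeriods.Grothendieck.GpcLegendreLemniscaticLine
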